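import Mathlib
import Summits.Ventures.PercRepro2.CoinChainEnteredPart

/-!
# The universal PURE chain when the R-covariance pays the pivotal law's positive part
(blind cell PercRepro2, night-2 g23; proofs/NIGHT2-DARC.md §63.14)

The world-1 functional splits as `U111 = ∑_W R(b0 x − b1)(b0 y − b2) − ∑_{W meets ent'} ν (d − d')(b0 x − b1)(b0 y − b2)`
— the cleared covariance of the world-1 `R`-law, `b0·(b0 b12 − b1 b2)`, minus the PIVOTAL law's
centred product on the entered clusters.  Bounding the pivotal sum pointwise by any `θ` that
dominates the centred product on the entered clusters (`θ = max(0, (b0 x − b1)(b0 y − b2))` is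
the natural choice) gives the sixth sufficient condition for (Q′):
`a0²·(b0 (b0 b12 − b1 b2) − ∑_{W meets ent'} ν (d − d') θ) + (b0 − g0)·Δ ≥ 0` — in words, the
`R`-covariance and the shift term pay the positive part of the pivotal law's centred product; it
holds whenever the gate is weak enough.  THEOREM `pureChain_functional_nonneg_of_pivotalPart`:
the pure chain at EVERY `ρ ∈ [0, 1]` under that condition.  Exact census: together with the five
conditions of CoinChainPivotalMean, CoinChainEnteredPart, CoinChainWorld0Corner and
CoinChainCleanBaseChain this covers EVERY anti-aligned check at n = 3, 4 (all pairs of up-set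
markers; 6,230,558 anti-aligned checks at n = 4, kit j294942) and n = 5 (point markers).
-/

namespace Summit.Ventures.PercRepro2.Coin

open Classical

section PivotalPart

variable {V : Type*} [DecidableEq V] {R : Type*} [Field R] [LinearOrder R] [IsStrictOrderedRing R]

/-- **The world-1 functional is the `R`-covariance minus the pivotal law's centred product.** -/
lemma pureChain_U111_split (U ent' : Finset V) (ν c d d' : Finset V → R) (x y : Finset V → R) :
    ((∑ W ∈ U.powerset, ν W * chainMix ∅ ent' 1 c d W) *
        (∑ W ∈ U.powerset, ν W * chainMix ∅ ent' 1 c d W) *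
        (∑ W ∈ U.powerset, ν W * chainMix ∅ ent' 1 c d' W * (x W * y W))
      - (∑ W ∈ U.powerset, ν W * chainMix ∅ ent' 1 c d W) *
        (∑ W ∈ U.powerset, ν W * chainMix ∅ ent' 1 c d W * y W) *
        (∑ W ∈ U.powerset, ν W * chainMix ∅ ent' 1 c d' W * x W)
      - (∑ W ∈ U.powerset, ν W * chainMix ∅ ent' 1 c d W) *
        (∑ W ∈ U.powerset, ν W * chainMix ∅ ent' 1 c d W * x W) *
        (∑ W ∈ U.powerset, ν W * chainMix ∅ ent' 1 c d' W * y W)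
      + (∑ W ∈ U.powerset, ν W * chainMix ∅ ent' 1 c d W * x W) *
        (∑ W ∈ U.powerset, ν W * chainMix ∅ ent' 1 c d W * y W) *
        (∑ W ∈ U.powerset, ν W * chainMix ∅ ent' 1 c d' W))
    = (∑ W ∈ U.powerset, ν W * chainMix ∅ ent' 1 c d W) *
        ((∑ W ∈ U.powerset, ν W * chainMix ∅ ent' 1 c d W) *
          (∑ W ∈ U.powerset, ν W * chainMix ∅ ent' 1 c d W * (x W * y W))
        - (∑ W ∈ U.powerset, ν W * chainMix ∅ ent' 1 c d W * x W) *
          (∑ W ∈ U.powerset, ν W * chainMix ∅ ent' 1 c d W * y W))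
      - ∑ W ∈ U.powerset.filter (fun W => ∃ r ∈ ent', r ∈ W), ν W * (d W - d' W) *
          (((∑ W ∈ U.powerset, ν W * chainMix ∅ ent' 1 c d W) * x W
              - (∑ W ∈ U.powerset, ν W * chainMix ∅ ent' 1 c d W * x W)) *
            ((∑ W ∈ U.powerset, ν W * chainMix ∅ ent' 1 c d W) * y W
              - (∑ W ∈ U.powerset, ν W * chainMix ∅ ent' 1 c d W * y W))) := by
  set b0 := ∑ W ∈ U.powerset, ν W * chainMix ∅ ent' 1 c d W with hb0
  set b1 := ∑ W ∈ U.powerset, ν W * chainMix ∅ ent' 1 c d W * x W with hb1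
  set b2 := ∑ W ∈ U.powerset, ν W * chainMix ∅ ent' 1 c d W * y W with hb2
  -- the pivotal law is the difference of the R-law and the gate on the entered clusters
  have hsplit : ∀ f : Finset V → R, (∑ W ∈ U.powerset, f W) =
      (∑ W ∈ U.powerset.filter (fun W => ¬ ∃ r ∈ ent', r ∈ W), f W) +
        (∑ W ∈ U.powerset.filter (fun W => ∃ r ∈ ent', r ∈ W), f W) := by
    intro f; rw [add_comm, Finset.sum_filter_add_sum_filter_not]
  have hmeet : ∀ W : Finset V, (∃ r ∈ ent', r ∈ W) → chainMix ∅ ent' 1 c d W = d W := by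
    intro W hW; apply chainMix_one_of_meet
    obtain ⟨r', hr', hrW⟩ := hW; exact ⟨r', by simpa using hr', hrW⟩
  have hmeet' : ∀ W : Finset V, (∃ r ∈ ent', r ∈ W) → chainMix ∅ ent' 1 c d' W = d' W := by
    intro W hW; apply chainMix_one_of_meet
    obtain ⟨r', hr', hrW⟩ := hW; exact ⟨r', by simpa using hr', hrW⟩
  have hnomeet : ∀ W : Finset V, (¬ ∃ r ∈ ent', r ∈ W) → chainMix ∅ ent' 1 c d W = c W := by
    intro W hW; apply chainMix_of_not_meet
    rintro ⟨r', hr', hrW⟩; exact hW ⟨r', by simpa using hr', hrW⟩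
  have hnomeet' : ∀ W : Finset V, (¬ ∃ r ∈ ent', r ∈ W) → chainMix ∅ ent' 1 c d' W = c W := by
    intro W hW; apply chainMix_of_not_meet
    rintro ⟨r', hr', hrW⟩; exact hW ⟨r', by simpa using hr', hrW⟩
  -- the centred sums of the R-law and of the gate
  have eR : ∑ W ∈ U.powerset, ν W * chainMix ∅ ent' 1 c d W * ((b0 * x W - b1) * (b0 * y W - b2))
      = b0 * (b0 * (∑ W ∈ U.powerset, ν W * chainMix ∅ ent' 1 c d W * (x W * y W)) - b1 * b2) := by
    rw [centred_expand]; ring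
  have eG : ∑ W ∈ U.powerset, ν W * chainMix ∅ ent' 1 c d' W * ((b0 * x W - b1) * (b0 * y W - b2))
      = b0 * b0 * (∑ W ∈ U.powerset, ν W * chainMix ∅ ent' 1 c d' W * (x W * y W))
        - b0 * b2 * (∑ W ∈ U.powerset, ν W * chainMix ∅ ent' 1 c d' W * x W)
        - b0 * b1 * (∑ W ∈ U.powerset, ν W * chainMix ∅ ent' 1 c d' W * y W)
        + b1 * b2 * (∑ W ∈ U.powerset, ν W * chainMix ∅ ent' 1 c d' W) := centred_expand _ _ _ _ _ _ _
  have ediff : ∑ W ∈ U.powerset, ν W * chainMix ∅ ent' 1 c d W * ((b0 * x W - b1) * (b0 * y W - b2))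
      - ∑ W ∈ U.powerset, ν W * chainMix ∅ ent' 1 c d' W * ((b0 * x W - b1) * (b0 * y W - b2))
      = ∑ W ∈ U.powerset.filter (fun W => ∃ r ∈ ent', r ∈ W), ν W * (d W - d' W) *
          ((b0 * x W - b1) * (b0 * y W - b2)) := by
    rw [hsplit (fun W => ν W * chainMix ∅ ent' 1 c d W * ((b0 * x W - b1) * (b0 * y W - b2))),
      hsplit (fun W => ν W * chainMix ∅ ent' 1 c d' W * ((b0 * x W - b1) * (b0 * y W - b2)))]
    have e1 : ∑ W ∈ U.powerset.filter (fun W => ¬ ∃ r ∈ ent', r ∈ W),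
        ν W * chainMix ∅ ent' 1 c d W * ((b0 * x W - b1) * (b0 * y W - b2))
        = ∑ W ∈ U.powerset.filter (fun W => ¬ ∃ r ∈ ent', r ∈ W),
        ν W * chainMix ∅ ent' 1 c d' W * ((b0 * x W - b1) * (b0 * y W - b2)) :=
      Finset.sum_congr rfl fun W hW => by
        rw [hnomeet W (Finset.mem_filter.1 hW).2, hnomeet' W (Finset.mem_filter.1 hW).2]
    have e2 : ∑ W ∈ U.powerset.filter (fun W => ∃ r ∈ ent', r ∈ W),
        ν W * chainMix ∅ ent' 1 c d W * ((b0 * x W - b1) * (b0 * y W - b2))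
        - ∑ W ∈ U.powerset.filter (fun W => ∃ r ∈ ent', r ∈ W),
        ν W * chainMix ∅ ent' 1 c d' W * ((b0 * x W - b1) * (b0 * y W - b2))
        = ∑ W ∈ U.powerset.filter (fun W => ∃ r ∈ ent', r ∈ W), ν W * (d W - d' W) *
          ((b0 * x W - b1) * (b0 * y W - b2)) := by
      rw [← Finset.sum_sub_distrib]
      refine Finset.sum_congr rfl fun W hW => ?_
      rw [hmeet W (Finset.mem_filter.1 hW).2, hmeet' W (Finset.mem_filter.1 hW).2]; ring
    linarith [e1, e2]
  have key : (b0 * b0 * (∑ W ∈ U.powerset, ν W * chainMix ∅ ent' 1 c d' W * (x W * y W))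
        - b0 * b2 * (∑ W ∈ U.powerset, ν W * chainMix ∅ ent' 1 c d' W * x W)
        - b0 * b1 * (∑ W ∈ U.powerset, ν W * chainMix ∅ ent' 1 c d' W * y W)
        + b1 * b2 * (∑ W ∈ U.powerset, ν W * chainMix ∅ ent' 1 c d' W))
      = b0 * (b0 * (∑ W ∈ U.powerset, ν W * chainMix ∅ ent' 1 c d W * (x W * y W)) - b1 * b2)
        - ∑ W ∈ U.powerset.filter (fun W => ∃ r ∈ ent', r ∈ W), ν W * (d W - d' W) *
          ((b0 * x W - b1) * (b0 * y W - b2)) := by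
    rw [← eG, ← eR, ← ediff]; ring
  linarith [key]

/-- **THE UNIVERSAL PURE CHAIN WHEN THE `R`-COVARIANCE PAYS THE PIVOTAL LAW'S POSITIVE PART.**
`θ` is any pointwise bound of the centred product `(b0 x − b1)(b0 y − b2)` on the entered clusters
(`hθ`); under `a0²·(b0 (b0 b12 − b1 b2) − ∑_{W meets ent'} ν (d − d') θ) + (b0 − g0)·Δ ≥ 0` the
pure chain functional is nonnegative at EVERY `ρ ∈ [0, 1]` for every pair of nonnegative increasing
markers. -/
theorem pureChain_functional_nonneg_of_pivotalPart (U ent' : Finset V) (ν c d d' : Finset V → R)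
    (ρ : R) (hρ0 : 0 ≤ ρ) (hρ1 : ρ ≤ 1) (hν0 : ∀ W, 0 ≤ ν W)
    (hν : ∀ s ⊆ U, ∀ t ⊆ U, ν s * ν t ≤ ν (s ∩ t) * ν (s ∪ t))
    (hc0 : ∀ W, 0 ≤ c W) (hd0 : ∀ W, 0 ≤ d W) (hd'0 : ∀ W, 0 ≤ d' W)
    (hdc : ∀ W, d W ≤ c W) (hd'c : ∀ W, d' W ≤ c W) (hd'd : ∀ W, d' W ≤ d W)
    (hcc : ∀ s t, c s * c t ≤ c (s ∩ t) * c (s ∪ t))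
    (hdd : ∀ s t, d s * d t ≤ d (s ∩ t) * d (s ∪ t))
    (hd'd' : ∀ s t, d' s * d' t ≤ d' (s ∩ t) * d' (s ∪ t))
    (hcd : ∀ s t, c s * d t ≤ c (s ∩ t) * d (s ∪ t))
    (hcd' : ∀ s t, c s * d' t ≤ c (s ∩ t) * d' (s ∪ t))
    (hdd' : ∀ s t, d s * d' t ≤ d (s ∩ t) * d' (s ∪ t))
    (hratio : ∀ s t, s ⊆ t → d s * c t ≤ c s * d t)
    (hratio' : ∀ s t, s ⊆ t → d' s * c t ≤ c s * d' t)
    (x y : Finset V → R) (hx0 : ∀ W, 0 ≤ x W) (hy0 : ∀ W, 0 ≤ y W)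
    (hxm : ∀ s t, x s ≤ x (s ∪ t)) (hym : ∀ s t, y s ≤ y (s ∪ t))
    (hpos0 : 0 < ∑ W ∈ U.powerset, ν W * c W)
    (hpos1 : 0 < ∑ W ∈ U.powerset, ν W * chainMix ∅ ent' 1 c d W)
    (θ : Finset V → R)
    (hθ : ∀ W ∈ U.powerset.filter (fun W => ∃ r ∈ ent', r ∈ W),
      ((∑ W ∈ U.powerset, ν W * chainMix ∅ ent' 1 c d W) * x W
          - (∑ W ∈ U.powerset, ν W * chainMix ∅ ent' 1 c d W * x W)) *
        ((∑ W ∈ U.powerset, ν W * chainMix ∅ ent' 1 c d W) * y W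
          - (∑ W ∈ U.powerset, ν W * chainMix ∅ ent' 1 c d W * y W)) ≤ θ W)
    (hW : 0 ≤ (∑ W ∈ U.powerset, ν W * c W) ^ 2 *
        ((∑ W ∈ U.powerset, ν W * chainMix ∅ ent' 1 c d W) *
            ((∑ W ∈ U.powerset, ν W * chainMix ∅ ent' 1 c d W) *
              (∑ W ∈ U.powerset, ν W * chainMix ∅ ent' 1 c d W * (x W * y W))
            - (∑ W ∈ U.powerset, ν W * chainMix ∅ ent' 1 c d W * x W) *
              (∑ W ∈ U.powerset, ν W * chainMix ∅ ent' 1 c d W * y W))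
          - ∑ W ∈ U.powerset.filter (fun W => ∃ r ∈ ent', r ∈ W), ν W * (d W - d' W) * θ W)
        + ((∑ W ∈ U.powerset, ν W * chainMix ∅ ent' 1 c d W) -
            (∑ W ∈ U.powerset, ν W * chainMix ∅ ent' 1 c d' W)) *
          (((∑ W ∈ U.powerset, ν W * chainMix ∅ ent' 1 c d W) * (∑ W ∈ U.powerset, ν W * c W * x W)
              - (∑ W ∈ U.powerset, ν W * c W) * (∑ W ∈ U.powerset, ν W * chainMix ∅ ent' 1 c d W * x W)) *
            ((∑ W ∈ U.powerset, ν W * chainMix ∅ ent' 1 c d W) * (∑ W ∈ U.powerset, ν W * c W * y W)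
              - (∑ W ∈ U.powerset, ν W * c W) * (∑ W ∈ U.powerset, ν W * chainMix ∅ ent' 1 c d W * y W)))) :
    0 ≤ (∑ W ∈ U.powerset, ν W * chainMix ∅ ent' ρ c d W) ^ 2 *
          (∑ W ∈ U.powerset, ν W * chainMix ∅ ent' ρ c d' W * (x W * y W))
        - (∑ W ∈ U.powerset, ν W * chainMix ∅ ent' ρ c d W) *
          (∑ W ∈ U.powerset, ν W * chainMix ∅ ent' ρ c d W * x W) *
          (∑ W ∈ U.powerset, ν W * chainMix ∅ ent' ρ c d' W * y W)
        - (∑ W ∈ U.powerset, ν W * chainMix ∅ ent' ρ c d W) *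
          (∑ W ∈ U.powerset, ν W * chainMix ∅ ent' ρ c d W * y W) *
          (∑ W ∈ U.powerset, ν W * chainMix ∅ ent' ρ c d' W * x W)
        + (∑ W ∈ U.powerset, ν W * chainMix ∅ ent' ρ c d W * x W) *
          (∑ W ∈ U.powerset, ν W * chainMix ∅ ent' ρ c d W * y W) *
          (∑ W ∈ U.powerset, ν W * chainMix ∅ ent' ρ c d' W) := by
  have hsplit := pureChain_U111_split U ent' ν c d d' x y
  -- the pivotal sum is bounded by the θ-sum termwise
  have hpiv : ∑ W ∈ U.powerset.filter (fun W => ∃ r ∈ ent', r ∈ W), ν W * (d W - d' W) *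
        (((∑ W ∈ U.powerset, ν W * chainMix ∅ ent' 1 c d W) * x W
            - (∑ W ∈ U.powerset, ν W * chainMix ∅ ent' 1 c d W * x W)) *
          ((∑ W ∈ U.powerset, ν W * chainMix ∅ ent' 1 c d W) * y W
            - (∑ W ∈ U.powerset, ν W * chainMix ∅ ent' 1 c d W * y W))) ≤
      ∑ W ∈ U.powerset.filter (fun W => ∃ r ∈ ent', r ∈ W), ν W * (d W - d' W) * θ W := by
    refine Finset.sum_le_sum fun W hW => ?_
    exact mul_le_mul_of_nonneg_left (hθ W hW) (mul_nonneg (hν0 W) (sub_nonneg.mpr (hd'd W)))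
  have hQ : 0 ≤ (∑ W ∈ U.powerset, ν W * c W) ^ 2 *
        ((∑ W ∈ U.powerset, ν W * chainMix ∅ ent' 1 c d W) *
            (∑ W ∈ U.powerset, ν W * chainMix ∅ ent' 1 c d W) *
            (∑ W ∈ U.powerset, ν W * chainMix ∅ ent' 1 c d' W * (x W * y W))
          - (∑ W ∈ U.powerset, ν W * chainMix ∅ ent' 1 c d W) *
            (∑ W ∈ U.powerset, ν W * chainMix ∅ ent' 1 c d W * y W) *
            (∑ W ∈ U.powerset, ν W * chainMix ∅ ent' 1 c d' W * x W)
          - (∑ W ∈ U.powerset, ν W * chainMix ∅ ent' 1 c d W) *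
            (∑ W ∈ U.powerset, ν W * chainMix ∅ ent' 1 c d W * x W) *
            (∑ W ∈ U.powerset, ν W * chainMix ∅ ent' 1 c d' W * y W)
          + (∑ W ∈ U.powerset, ν W * chainMix ∅ ent' 1 c d W * x W) *
            (∑ W ∈ U.powerset, ν W * chainMix ∅ ent' 1 c d W * y W) *
            (∑ W ∈ U.powerset, ν W * chainMix ∅ ent' 1 c d' W))
        + ((∑ W ∈ U.powerset, ν W * chainMix ∅ ent' 1 c d W) -
            (∑ W ∈ U.powerset, ν W * chainMix ∅ ent' 1 c d' W)) *
          (((∑ W ∈ U.powerset, ν W * chainMix ∅ ent' 1 c d W) * (∑ W ∈ U.powerset, ν W * c W * x W)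
              - (∑ W ∈ U.powerset, ν W * c W) * (∑ W ∈ U.powerset, ν W * chainMix ∅ ent' 1 c d W * x W)) *
            ((∑ W ∈ U.powerset, ν W * chainMix ∅ ent' 1 c d W) * (∑ W ∈ U.powerset, ν W * c W * y W)
              - (∑ W ∈ U.powerset, ν W * c W) * (∑ W ∈ U.powerset, ν W * chainMix ∅ ent' 1 c d W * y W))) := by
    rw [hsplit]
    have := mul_le_mul_of_nonneg_left hpiv (sq_nonneg (∑ W ∈ U.powerset, ν W * c W))
    linarith [hW, this]
  exact pureChain_functional_nonneg_of_Qprime U ent' ν c d d' ρ hρ0 hρ1 hν0 hν hc0 hd0 hd'0 hdc hd'c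
    hcc hdd hd'd' hcd hcd' hdd' hratio hratio' x y hx0 hy0 hxm hym hpos0 hpos1 hQ

end PivotalPart

end Summit.Ventures.PercRepro2.Coin
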